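import Summits.CriticalPhenomena.SAWScalingLimit.Theorems.SAWLoopFugacityFlowAvoidanceLimitRatioOscillationSiteDictionary
import Literature.Probability.LatticeModels.BoundaryPoleGreenBounds

/-!
# Interior one-scale Harnack inequality for the edge-killed walk on a full lattice box
— UBHP step-zero brick B-harnack of line `symplectic-fermion-anchor`
(crux `SAWLoopFugacityFlow.AvoidanceLimit`, stmt-CriticalPhenomena-10649; lead c3)

The uniform boundary Harnack principle `stub_uniformBHP` (UBHP) of the line concerns functions
`h : Λ → ℝ` on a volume `Λ ⊆ ℤ²` that are harmonic for the EDGE-killed walk of a subgraph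
`H ≤ ℤ²` restricted to `Λ`: `(P h)(x) = h(x)` with `P = ¼·adjMat H Λ`. In the bulk of the domain —
on a lattice box `mW v k` (radius `48k`) every site of which lies in `Λ` together with its four
lattice neighbours, all four lattice edges being `H`-edges — the edge-killed walk IS the simple
random walk, so `P`-harmonicity of `h` on the box is lattice harmonicity (`Δ = 0`) of the zero
extension of `h` off `Λ` (the site dictionary `transition_mulVec_eq_iff_latticeLaplacian_eq_zero`
of `…RatioOscillationSiteDictionary.lean`, whose "induced at `x`" hypothesis is exactly fullness at
`x`). The tree's one-scale Harnack inequality on boxes (`harnack_box`,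
`Literature/Probability/LatticeModels/BoundaryPoleGreenBounds.lean`, from `harnack_one_scale` of
`LatticeHarnackOneScale.lean`: Lawler–Schramm–Werner 2004, Lemma 5.2) then gives

* `transitionHarmonic_harnack_box` (registered signature) — for `h ≥ 0` on `Λ`, `P`-harmonic at the
  sites of the full box `mW v k` (`k ≥ 1`), and every `x ∈ Λ` in the small box `mB v k`
  (radius `12k`): `(maneuverConst/2) · h(v) ≤ h(x)`.

This is the interior input of the boundary Harnack / Carleson arguments for `stub_uniformBHP`.
Sources: folklore (Lawler–Schramm–Werner 2004, Lemma 5.2; Lawler–Limic 2010, Thm. 6.3.9, both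
already in the tree as `harnack_one_scale`). No definitions.
-/

noncomputable section

open scoped BigOperators Classical
open Finset
open Literature.Probability.RandomPlanarGeometry Literature.Probability.LatticeModels

namespace Summit.CriticalPhenomena.SAWScalingLimit.Theorems.AvoidanceLimit.Anchor

open KilledGreen

/-- **Fullness at a site is inducedness at that site.** If every lattice neighbour `y` of `x` lies
in `Λ` and is `H`-adjacent to `x`, and `H ≤ ℤ²`, then `H.Adj x y ↔ x ∼_{ℤ²} y ∧ y ∈ Λ` — the
hypothesis of the site dictionary `transition_mulVec_eq_iff_latticeLaplacian_eq_zero`. [folklore] -/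
theorem adj_iff_of_full {H : SimpleGraph (Site 2)} (hH : H ≤ zdGraph 2) {Λ : Finset (Site 2)}
    {x : Site 2} (hfull : ∀ y : Site 2, (zdGraph 2).Adj x y → y ∈ Λ ∧ H.Adj x y) (y : Site 2) :
    H.Adj x y ↔ (zdGraph 2).Adj x y ∧ y ∈ Λ :=
  ⟨fun h => ⟨hH h, (hfull y (hH h)).1⟩, fun h => (hfull y h.1).2⟩

/-- **Edge-killed harmonicity on a full region is lattice harmonicity of the zero extension.**
If every site of `T` lies in `Λ` with its four lattice neighbours, all four lattice edges being
`H`-edges (`H ≤ ℤ²`), and `h : Λ → ℝ` is `P_{H|Λ}`-harmonic at the sites of `T`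
(`(¼·adjMat H Λ) h = h` there), then the zero extension of `h` off `Λ` is lattice harmonic on `T`.
[folklore] -/
theorem isLatticeHarmonicOn_dite_of_full {H : SimpleGraph (Site 2)} (hH : H ≤ zdGraph 2)
    (Λ : Finset (Site 2)) (h : ↥Λ → ℝ) {T : Set (Site 2)}
    (hfull : ∀ x ∈ T, x ∈ Λ ∧ ∀ y : Site 2, (zdGraph 2).Adj x y → y ∈ Λ ∧ H.Adj x y)
    (hharm : ∀ x : ↥Λ, (x : Site 2) ∈ T → Matrix.mulVec ((4 : ℝ)⁻¹ • adjMat H Λ) h x = h x) :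
    IsLatticeHarmonicOn (fun v => if hv : v ∈ Λ then h ⟨v, hv⟩ else 0) T := by
  intro x hxT
  obtain ⟨hxΛ, hfx⟩ := hfull x hxT
  exact (transition_mulVec_eq_iff_latticeLaplacian_eq_zero ⟨x, hxΛ⟩ (adj_iff_of_full hH hfx) h).1
    (hharm ⟨x, hxΛ⟩ hxT)

/-- **Registered brick B-harnack: interior one-scale Harnack inequality for the edge-killed walk.**
For every subgraph `H ≤ ℤ²`, volume `Λ`, nonnegative `h : Λ → ℝ`, centre `v` and `k ≥ 1` such that
the box `mW v k` of radius `48k` is FULL (each of its sites lies in `Λ`, and each of the four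
lattice neighbours of such a site lies in `Λ` and is joined to it in `H`) and `h` is
`P_{H|Λ}`-harmonic at the sites of `mW v k` (`P = ¼·adjMat H Λ`), one has
`(maneuverConst/2) · h(v) ≤ h(x)` for every `x ∈ Λ` in the box `mB v k` of radius `12k`.
Proof: the zero extension of `h` is nonnegative and lattice harmonic on `mW v k`
(`isLatticeHarmonicOn_dite_of_full`), so the tree's `harnack_box` (Lawler–Schramm–Werner 2004,
Lemma 5.2, on the hole-free box `mW v k`) applies. [folklore] -/
theorem transitionHarmonic_harnack_box :
    ∀ (H : SimpleGraph (Site 2)), H ≤ zdGraph 2 → ∀ (Λ : Finset (Site 2)) (h : ↥Λ → ℝ),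
      (∀ x, 0 ≤ h x) → ∀ (v : Site 2) (k : ℕ), 0 < k →
      (∀ x ∈ mW v k, x ∈ Λ ∧ ∀ y : Site 2, (zdGraph 2).Adj x y → y ∈ Λ ∧ H.Adj x y) →
      (∀ x : ↥Λ, (x : Site 2) ∈ mW v k → Matrix.mulVec ((4 : ℝ)⁻¹ • adjMat H Λ) h x = h x) →
      ∀ (hv : v ∈ Λ) (x : ↥Λ), (x : Site 2) ∈ mB v k → maneuverConst / 2 * h ⟨v, hv⟩ ≤ h x := by
  intro H hH Λ h hnn v k hk hfull hharm hv x hx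
  set g : Site 2 → ℝ := fun w => if hw : w ∈ Λ then h ⟨w, hw⟩ else 0 with hg
  -- the zero extension is nonnegative everywhere
  have hg_nonneg : ∀ z, 0 ≤ g z := fun z => by
    by_cases hz : z ∈ Λ
    · simp only [hg, hz, dite_true]; exact hnn _
    · simp [hg, hz]
  -- and lattice harmonic on the full box
  have hgh : IsLatticeHarmonicOn g (mW v k) := isLatticeHarmonicOn_dite_of_full hH Λ h hfull hharm
  -- one-scale Harnack on the (hole-free) box of radius `48k`
  have key := harnack_box v hk hgh hg_nonneg hx
  have hgv : g v = h ⟨v, hv⟩ := by simp [hg, hv]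
  have hgx : g x = h x := by simp [hg, x.2]
  rwa [hgv, hgx] at key

end Summit.CriticalPhenomena.SAWScalingLimit.Theorems.AvoidanceLimit.Anchor

end
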